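import Mathlib
import Summits.Ventures.PercRepro2.LeafRowCutTwoFarOB
import Summits.Ventures.PercRepro2.LeafRowCutTwoFarVB
import Summits.Ventures.PercRepro2.LeafRowCutTwoFarOV
import Summits.Ventures.PercRepro2.LeafRowCutTwoFarRoots

/-!
# Two or three of `o`, `b`, `v` together behind one cut vertex: row (LEAF-½) outright
(blind cell PercRepro2, p5 g29; `proofs/P5-OEDGE.md` §39)

The four class theorems of `LeafRowCutTwoFar{OB,VB,OV,Roots}.lean` in the vocabulary of the row
(LEAF-½) `LeafStep.LeafRow p ends o a₁ a₂ v b` (`v` = the attachment vertex of the leaf `a₃`,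
`z` = the cut vertex): with `z` a cut vertex (`CutVertex ends side L z Rt`) and the roots
`a₁, a₂` on the right (or at `z`),

* **`LeafRow_ob_behind_cut`**: `o` and `b` on the left (or at `z`), `v` on the right (or at `z`)
  — the diagonal reduction (`R½ = P₁P₂·R½(o = b = z) + (q_all − P₁P₂)·P(Q)²·OPP`; Harris on
  the part + the coincidence row `b = o`);
* **`LeafRow_vb_behind_cut`**: `v` and `b` on the left, `o` on the right — the leaf-at-`b`
  reduction (`R½ = P_b·((1 − P_v)·T₀ + P_v·R½(v = b = z))`; `T₀ ≥ 0` + the coincidence row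
  `v = b`, no Harris input);
* **`LeafRow_ov_behind_cut`**: `o` and `v` on the left, `b` on the right — `R½ = (q_x1 +
  q_all/2)·T₀(o := z)`, a nonnegative multiple of `T₀ ≥ 0`;
* **`LeafRow_obv_behind_cut`**: `o`, `b` and `v` all on the left (both roots together behind `z`)
  — `R½` is a product of probabilities;
* **`LeafRow_of_two_behind_cut`** (and its mirror **`LeafRow_of_two_behind_cut'`**): the umbrella
  — every one of `o, v, b` on one side of `z` (or at `z`), at least two of them on the side away
  from the roots ⟹ the row.

Together with `CutLeafRowSix.LeafRow_of_cut_sep` (a cut vertex separating the roots, `b, o, v` not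
all on one side) and the one-far-mark reductions of `LeafRowCutOneFar.lean` (a non-root mark alone
behind a cut vertex), a counterexample to the row would have to have `o`, `b`, `v` in the block of
the roots, or a root alone behind a cut vertex.  Every theorem is unconditional for every
admissible weight vector and every weighted part on either side.  Own work; standard axioms.
-/

namespace Summit.Ventures.PercRepro2

open CovForm CutVertexM9 UnionCluster CutTwoFar LeafStep

namespace LeafRowCutTwoFar

section Assembly

variable {V : Type*} {E : Type*} [Fintype E] [DecidableEq E] [Fintype V] [DecidableEq V]
  {R : Type*} [Field R] [LinearOrder R] [IsStrictOrderedRing R]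
variable {ends : E → Sym2 V} {side : E → Bool} {L : Set V} {z : V} {Rt : Set V}

/-- **`o` and `b` together behind a cut vertex `z`** (`v` and the roots on the other side or at
`z`): the row. -/
theorem LeafRow_ob_behind_cut (h : CutVertex ends side L z Rt) {p : E → R} (hp : IsProbVec p)
    {o a₁ a₂ v b : V} (ho : o ∈ L ∨ o = z) (hb : b ∈ L ∨ b = z) (h1 : a₁ ∈ Rt ∨ a₁ = z)
    (h2 : a₂ ∈ Rt ∨ a₂ = z) (hv : v ∈ Rt ∨ v = z) : LeafRow p ends o a₁ a₂ v b :=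
  LeafRow_obFar h hp ho hb h1 h2 hv

/-- **`v` and `b` together behind a cut vertex `z`** (`o` and the roots on the other side or at
`z`): the row. -/
theorem LeafRow_vb_behind_cut (h : CutVertex ends side L z Rt) {p : E → R} (hp : IsProbVec p)
    {o a₁ a₂ v b : V} (hv : v ∈ L ∨ v = z) (hb : b ∈ L ∨ b = z) (h1 : a₁ ∈ Rt ∨ a₁ = z)
    (h2 : a₂ ∈ Rt ∨ a₂ = z) (ho : o ∈ Rt ∨ o = z) : LeafRow p ends o a₁ a₂ v b :=
  LeafRow_a3bFar h hp hv hb h1 h2 ho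

/-- **`o` and `v` together behind a cut vertex `z`** (`b` and the roots on the other side or at
`z`): the row. -/
theorem LeafRow_ov_behind_cut (h : CutVertex ends side L z Rt) {p : E → R} (hp : IsProbVec p)
    {o a₁ a₂ v b : V} (ho : o ∈ L ∨ o = z) (hv : v ∈ L ∨ v = z) (h1 : a₁ ∈ Rt ∨ a₁ = z)
    (h2 : a₂ ∈ Rt ∨ a₂ = z) (hb : b ∈ Rt ∨ b = z) : LeafRow p ends o a₁ a₂ v b :=
  LeafRow_oa3Far h hp ho hv h1 h2 hb

omit [Fintype V] [DecidableEq V] in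
/-- **`o`, `b` and `v` all together behind a cut vertex `z`** (both roots on the other side or at
`z`): the row. -/
theorem LeafRow_obv_behind_cut (h : CutVertex ends side L z Rt) {p : E → R} (hp : IsProbVec p)
    {o a₁ a₂ v b : V} (ho : o ∈ L ∨ o = z) (hb : b ∈ L ∨ b = z) (hv : v ∈ L ∨ v = z)
    (h1 : a₁ ∈ Rt ∨ a₁ = z) (h2 : a₂ ∈ Rt ∨ a₂ = z) : LeafRow p ends o a₁ a₂ v b :=
  LeafRow_rootsFar h.symm h1 h2 hp ho hv hb

/-- **THE UMBRELLA**: `z` a cut vertex, the roots on the right (or at `z`), each of `o, v, b` on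
one side (or at `z`), and at least two of `o, v, b` on the left ⟹ the row. -/
theorem LeafRow_of_two_behind_cut (h : CutVertex ends side L z Rt) {p : E → R} (hp : IsProbVec p)
    {o a₁ a₂ v b : V} (h1 : a₁ ∈ Rt ∨ a₁ = z) (h2 : a₂ ∈ Rt ∨ a₂ = z)
    (hside : ∀ m ∈ ({o, v, b} : Set V), (m ∈ L ∨ m = z) ∨ (m ∈ Rt ∨ m = z))
    (htwo : (o ∈ L ∨ o = z) ∧ (b ∈ L ∨ b = z) ∨ (o ∈ L ∨ o = z) ∧ (v ∈ L ∨ v = z) ∨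
      (b ∈ L ∨ b = z) ∧ (v ∈ L ∨ v = z)) :
    LeafRow p ends o a₁ a₂ v b := by
  rcases htwo with ⟨ho, hb⟩ | ⟨ho, hv⟩ | ⟨hb, hv⟩
  · rcases hside v (by simp) with hv | hv
    · exact LeafRow_obv_behind_cut h hp ho hb hv h1 h2
    · exact LeafRow_ob_behind_cut h hp ho hb h1 h2 hv
  · rcases hside b (by simp) with hb | hb
    · exact LeafRow_obv_behind_cut h hp ho hb hv h1 h2
    · exact LeafRow_ov_behind_cut h hp ho hv h1 h2 hb
  · rcases hside o (by simp) with ho | ho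
    · exact LeafRow_obv_behind_cut h hp ho hb hv h1 h2
    · exact LeafRow_vb_behind_cut h hp hv hb h1 h2 ho

/-- **THE UMBRELLA, MIRRORED**: the roots on the left (or at `z`), at least two of `o, v, b` on
the right ⟹ the row. -/
theorem LeafRow_of_two_behind_cut' (h : CutVertex ends side L z Rt) {p : E → R} (hp : IsProbVec p)
    {o a₁ a₂ v b : V} (h1 : a₁ ∈ L ∨ a₁ = z) (h2 : a₂ ∈ L ∨ a₂ = z)
    (hside : ∀ m ∈ ({o, v, b} : Set V), (m ∈ Rt ∨ m = z) ∨ (m ∈ L ∨ m = z))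
    (htwo : (o ∈ Rt ∨ o = z) ∧ (b ∈ Rt ∨ b = z) ∨ (o ∈ Rt ∨ o = z) ∧ (v ∈ Rt ∨ v = z) ∨
      (b ∈ Rt ∨ b = z) ∧ (v ∈ Rt ∨ v = z)) :
    LeafRow p ends o a₁ a₂ v b :=
  LeafRow_of_two_behind_cut h.symm hp h1 h2 hside htwo

end Assembly

end LeafRowCutTwoFar

end Summit.Ventures.PercRepro2
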